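import Mathlib
import HarnessLib
import Summits.NavierStokesRegularity.NavierStokesRegularity.Theses.QuarterLogPincer
import Summits.NavierStokesRegularity.NavierStokesRegularity.Theorems.QuarterLogPincerThinCascadeDefs
import Summits.NavierStokesRegularity.NavierStokesRegularity.Theorems.QuarterLogPincerTruncationEdgeDefs
import Literature.Analysis.FluidPDE.SelfSimilar
import Literature.Analysis.FluidPDE.TypeIAncientMild
import Literature.Analysis.FluidPDE.DyadicChaining
import Literature.Analysis.FluidPDE.HyperbolicDSSOrbit

/-!
# Route `QuarterLogPincer`, crux `TypeIQuantSubcubicExp` (stmt-NavierStokesRegularity-24077), EDGE line `truncation_edge`: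
  the ARITHMETIC CORE (a truncated family refutes the crux at its Type-I constant) and the ASSEMBLY of a truncated
  family from the parts T1/T3/T4 — kernel theorems of the line, re-homed

Author of every statement and proof below: **ns-idea-7 g8** (line `truncation_edge`, tree copy
`Cruxes/TypeIQuantSubcubicExp/Lines/truncation_edge.lean` v1.3 sha12 `869d7774c0da`; critics idea-crit-4 g5 PASS 18:45:39Z,
idea-crit-7 g3 backstop 18:47:24Z, 2026-08-28).  Texts VERBATIM (same namespace `…Cruxes.TypeIQuantSubcubicExp.TruncationEdge`,
same names; the two elementary lemmas `sqrt_exp_neg`, `add_pow_three_le` are the tree's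
`Literature.Analysis.FluidPDE.sqrt_exp_neg`, `DyadicChaining.add_pow_three_le_four`), only re-homed into an importable module over the landed Defs (`QuarterLogPincerTruncationEdgeDefs`, p660448) —
crux workfiles under `Cruxes/` are not importable from `Theorems/`.  Landed by nsreg-C26-p1 g7 (DIRECTOR-NS #259 (2) hand on
24077), `--supports stmt-NavierStokesRegularity-24077` (helper).

* `typeIQuantSubcubicExp_iff_forall` — the crux is `∀ M, QuantSubcubicExpAt M` (definitional);
* `not_quantSubcubicExpAt_of_truncatedFamily` — THE ARITHMETIC CORE: a truncated family at Type-I constant `M'` with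
  cube-log budget `A³ ≤ K₁ + K₂ log(1/ε)` and floor `c ε^{−1/2}` refutes the crux's instance at `M'`
  (`exp(L/4) ≤ Q` for all large `L` is false); `not_typeIQuantSubcubicExp_of_truncatedFamily`;
* `truncatedFamily_of_parts` — envelope `A ≥ 0` + T1-output `FarFieldTruncation M v` + T3 `EnvelopeCubeBudget v` +
  T4 `RateFloor v` ⇒ a truncated family at constant `M + 1` (`K₁ = 32 + 16(B+K)(1 + log K)`, `K₂ = 16(B+K)(κ+1) + 1`).

The edges (24077 ⇒ 22144 / 24453 / 24374 / (E1⁺) / `TypeIDSSLiouvilleConjecture`, modulo T1 only) are in the companion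
module `QuarterLogPincerTruncationEdgeTransfer`.  HONEST FRAME: arithmetic and bookkeeping about HYPOTHETICAL Tao-frame
families; the crux 24077, its input T1, the wall 22144 / W7 and Navier–Stokes regularity are OPEN / not proved.
-/

noncomputable section

-- the summit-side namespace repeats a component by design (D-0017)
set_option linter.dupNamespace false

namespace Summit.NavierStokesRegularity.NavierStokesRegularity.Cruxes.TypeIQuantSubcubicExp.TruncationEdge

open MeasureTheory Set Function Metric Filter Topology
open scoped ENNReal NNReal
open Literature.Analysis Literature.Analysis.FluidPDE
open Summit.NavierStokesRegularity.NavierStokesRegularity.Cruxes.TypeIQuantSubcubicExp.ThinCascade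
  (TaoFrame ThinObject SingularAt)

/-! ### The crux at a fixed Type-I constant -/

/-- The crux is the conjunction of its fixed-constant instances (definitional). [folklore] -/
theorem typeIQuantSubcubicExp_iff_forall :
    Summit.NavierStokesRegularity.NavierStokesRegularity.Theses.QuarterLogPincer.TypeIQuantSubcubicExp ↔
      ∀ M : ℝ, QuantSubcubicExpAt M :=
  Iff.rfl

/-! ### The arithmetic core -/

/-- `(1 − ε)^{−1/2} ≤ 2` for `0 < ε ≤ 1/2`. [folklore] -/
theorem rpow_neg_half_le_two {ε : ℝ} (hε : 0 < ε) (hε' : ε ≤ 1 / 2) :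
    (1 - ε : ℝ) ^ (-(1 / 2 : ℝ)) ≤ 2 := by
  have h0 : (0 : ℝ) < 1 - ε := by linarith
  have h1 : (1 - ε : ℝ) ≤ 1 := by linarith
  have hhalf : (1 - ε : ℝ) ^ (1 : ℝ) ≤ (1 - ε) ^ (1 / 2 : ℝ) :=
    Real.rpow_le_rpow_of_exponent_ge h0 h1 (by norm_num)
  rw [Real.rpow_one] at hhalf
  have hge : (1 / 2 : ℝ) ≤ (1 - ε) ^ (1 / 2 : ℝ) := by linarith
  have hpos : (0 : ℝ) < (1 - ε) ^ (1 / 2 : ℝ) := by positivity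
  rw [Real.rpow_neg h0.le]
  rw [inv_le_comm₀ hpos (by norm_num : (0 : ℝ) < 2)]
  linarith

/-- **THE ARITHMETIC CORE (PROVED).** A truncated family at Type-I constant `M'` refutes the crux's
instance at `M'`: along `A³ = K₁ + K₂ log(1/ε)` the floor forces `F(A) ≥ (c/4)·exp((A³−K₁)/(2K₂))`,
against `F(A) ≤ exp(A³/(4K₂))` eventually. [line theorem of `Cruxes/TypeIQuantSubcubicExp/Lines/truncation_edge.lean` v1.3 (ns-idea-7 g8), verbatim] -/
theorem not_quantSubcubicExpAt_of_truncatedFamily {M' K₁ K₂ c ε₀ : ℝ} (hK₂ : 0 < K₂) (hc : 0 < c)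
    (hε₀ : 0 < ε₀) (hε₀' : ε₀ ≤ 1 / 2) (hTF : TruncatedFamily M' K₁ K₂ c ε₀) :
    ¬ QuantSubcubicExpAt M' := by
  rintro ⟨F, hgrowth, hbound⟩
  obtain ⟨A₀, hA₀⟩ := hgrowth (1 / (4 * K₂)) (by positivity)
  -- a threshold `A₁ ≥ 2` beyond which the growth clause applies
  set A₁ : ℝ := max A₀ 2 with hA₁
  have hA₁two : (2 : ℝ) ≤ A₁ := le_max_right _ _
  have hA₁A₀ : A₀ ≤ A₁ := le_max_left _ _
  -- KEY CLAIM: for every admissible `ε`, `(c/2)/√ε ≤ F A'` for every `A'` above the family's bound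
  have key : ∀ ε ∈ Set.Ioc (0 : ℝ) ε₀, ∃ A : ℝ, 2 ≤ A ∧ A ^ 3 ≤ K₁ + K₂ * Real.log (1 / ε) ∧
      ∀ A' : ℝ, A ≤ A' → c / 2 / Real.sqrt ε ≤ F A' := by
    intro ε hε
    obtain ⟨A, u, p, hframe, hrate, hL3, hA2, hA3, x, hx⟩ := hTF ε hε
    refine ⟨A, hA2, hA3, fun A' hAA' => ?_⟩
    have hεpos : 0 < ε := hε.1
    have hεhalf : ε ≤ 1 / 2 := hε.2.trans hε₀'
    have hL3' : ∀ t ∈ Set.Icc 0 (1 - ε), eLpNorm (u t) 3 volume ≤ ENNReal.ofReal A' :=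
      fun t ht => (hL3 t ht).trans (ENNReal.ofReal_le_ofReal hAA')
    have hb := hbound (1 - ε) ε A' u p hframe hεpos hrate hL3' (hA2.trans hAA') (1 - ε)
      ⟨by linarith, le_rfl⟩ x
    -- `c/√ε ≤ ‖u(1−ε) x‖ ≤ F A' · (1−ε)^{−1/2} ≤ 2 F A'`
    have hsq : 0 < Real.sqrt ε := Real.sqrt_pos.2 hεpos
    have hfloor : 0 < c / Real.sqrt ε := div_pos hc hsq
    have hq := rpow_neg_half_le_two hεpos hεhalf
    have hqpos : (0 : ℝ) < (1 - ε) ^ (-(1 / 2 : ℝ)) := Real.rpow_pos_of_pos (by linarith) _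
    have hFpos : 0 < F A' := by
      by_contra hF
      push Not at hF
      have : F A' * (1 - ε) ^ (-(1 / 2 : ℝ)) ≤ 0 := mul_nonpos_of_nonpos_of_nonneg hF hqpos.le
      linarith
    have h2 : F A' * (1 - ε) ^ (-(1 / 2 : ℝ)) ≤ F A' * 2 := mul_le_mul_of_nonneg_left hq hFpos.le
    have h3 : c / Real.sqrt ε ≤ F A' * 2 := (hx.trans hb).trans h2
    rw [div_div, div_le_iff₀ (by positivity)]
    calc c = c / Real.sqrt ε * Real.sqrt ε := by field_simp
      _ ≤ F A' * 2 * Real.sqrt ε := mul_le_mul_of_nonneg_right h3 hsq.le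
      _ = F A' * (2 * Real.sqrt ε) := by ring
  -- the constant `Q` and the depth `L`
  set Q : ℝ := 2 / c * Real.exp ((K₁ + A₁ ^ 3) / (4 * K₂)) with hQ
  have hQpos : 0 < Q := by positivity
  set L : ℝ := max (4 * Real.log Q) (Real.log (1 / ε₀)) + 1 with hL
  have hL4 : 4 * Real.log Q < L := by
    have := le_max_left (4 * Real.log Q) (Real.log (1 / ε₀)); linarith
  have hLε₀ : Real.log (1 / ε₀) < L := by
    have := le_max_right (4 * Real.log Q) (Real.log (1 / ε₀)); linarith
  set ε : ℝ := Real.exp (-L) with hεdef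
  have hεpos : 0 < ε := Real.exp_pos _
  have hεle : ε ≤ ε₀ := by
    rw [hεdef, ← Real.le_log_iff_exp_le hε₀]
    have : Real.log (1 / ε₀) = -Real.log ε₀ := by rw [one_div, Real.log_inv]
    linarith
  have hlogε : Real.log (1 / ε) = L := by
    rw [hεdef, one_div, Real.log_inv, Real.log_exp, neg_neg]
  have hsqrtε : Real.sqrt ε = Real.exp (-L / 2) := by rw [hεdef, Literature.Analysis.FluidPDE.sqrt_exp_neg]
  obtain ⟨A, hA2, hA3, hF⟩ := key ε ⟨hεpos, hεle⟩
  rw [hlogε] at hA3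
  -- evaluate at `A' = max A A₁ ≥ A₀`
  set A' : ℝ := max A A₁ with hA'
  have hAA' : A ≤ A' := le_max_left _ _
  have hA'A₀ : A₀ ≤ A' := hA₁A₀.trans (le_max_right _ _)
  have hlow := hF A' hAA'
  have hup := hA₀ A' hA'A₀
  -- `A'^3 ≤ A^3 + A₁^3`
  have hApos : 0 ≤ A := by linarith
  have hA₁pos : 0 ≤ A₁ := by linarith
  have hcube : A' ^ 3 ≤ A ^ 3 + A₁ ^ 3 := by
    rcases le_total A A₁ with h | h
    · rw [hA', max_eq_right h]; nlinarith [pow_nonneg hApos 3]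
    · rw [hA', max_eq_left h]; nlinarith [pow_nonneg hA₁pos 3]
  -- upper bound: `F A' ≤ exp((K₁ + A₁³)/(4K₂)) · exp(L/4)`
  have hup' : F A' ≤ Real.exp ((K₁ + A₁ ^ 3) / (4 * K₂)) * Real.exp (L / 4) := by
    refine hup.trans ?_
    rw [← Real.exp_add, Real.exp_le_exp]
    have h1 : 1 / (4 * K₂) * A' ^ 3 ≤ 1 / (4 * K₂) * (A ^ 3 + A₁ ^ 3) :=
      mul_le_mul_of_nonneg_left hcube (by positivity)
    have h2 : 1 / (4 * K₂) * (A ^ 3 + A₁ ^ 3) ≤ 1 / (4 * K₂) * (K₁ + K₂ * L + A₁ ^ 3) :=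
      mul_le_mul_of_nonneg_left (by linarith) (by positivity)
    have h3 : 1 / (4 * K₂) * (K₁ + K₂ * L + A₁ ^ 3) = (K₁ + A₁ ^ 3) / (4 * K₂) + L / 4 := by
      field_simp
      ring
    linarith
  -- lower bound: `(c/2) exp(L/2) ≤ F A'`
  have hlow' : c / 2 * Real.exp (L / 2) ≤ F A' := by
    rw [hsqrtε] at hlow
    have : c / 2 / Real.exp (-L / 2) = c / 2 * Real.exp (L / 2) := by
      rw [div_eq_mul_inv, ← Real.exp_neg]
      congr 2
      ring
    rwa [this] at hlow
  -- compare: `exp(L/4) ≤ Q`, i.e. `L ≤ 4 log Q`, contradiction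
  have hexp : Real.exp (L / 2) = Real.exp (L / 4) * Real.exp (L / 4) := by
    rw [← Real.exp_add]; congr 1; ring
  have hE4 : 0 < Real.exp (L / 4) := Real.exp_pos _
  have hcomb : c / 2 * (Real.exp (L / 4) * Real.exp (L / 4)) ≤
      Real.exp ((K₁ + A₁ ^ 3) / (4 * K₂)) * Real.exp (L / 4) := by
    rw [← hexp]; exact hlow'.trans hup'
  have hE : Real.exp (L / 4) ≤ Q := by
    rw [hQ]
    have h1 : c / 2 * Real.exp (L / 4) ≤ Real.exp ((K₁ + A₁ ^ 3) / (4 * K₂)) :=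
      le_of_mul_le_mul_right (by nlinarith [hcomb]) hE4
    rw [div_mul_eq_mul_div, le_div_iff₀ hc]
    nlinarith [h1]
  have hlog : L / 4 ≤ Real.log Q := by
    have := Real.log_le_log hE4 hE
    rwa [Real.log_exp] at this
  linarith

/-- A truncated family at `M'` refutes the crux. [line theorem of `Cruxes/TypeIQuantSubcubicExp/Lines/truncation_edge.lean` v1.3 (ns-idea-7 g8), verbatim] -/
theorem not_typeIQuantSubcubicExp_of_truncatedFamily {M' K₁ K₂ c ε₀ : ℝ} (hK₂ : 0 < K₂) (hc : 0 < c)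
    (hε₀ : 0 < ε₀) (hε₀' : ε₀ ≤ 1 / 2) (hTF : TruncatedFamily M' K₁ K₂ c ε₀) :
    ¬ Summit.NavierStokesRegularity.NavierStokesRegularity.Theses.QuarterLogPincer.TypeIQuantSubcubicExp :=
  fun h => not_quantSubcubicExpAt_of_truncatedFamily hK₂ hc hε₀ hε₀' hTF (h M')

/-! ### Assembly of the truncated family from the parts -/

/-- **From the parts to a truncated family (PROVED).** Envelope `A ≥ 0`, T1 at accuracy
`δ = min 1 (c/2)`, T3's budget with `log R ≤ log K + κ log(1/ε)`, T4's floor localised into the unit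
ball by the envelope for `ε ≤ (c/(2(A+c)))²`. [line theorem of `Cruxes/TypeIQuantSubcubicExp/Lines/truncation_edge.lean` v1.3 (ns-idea-7 g8), verbatim] -/
theorem truncatedFamily_of_parts {M A : ℝ}
    {v : ℝ → EuclideanSpace ℝ (Fin 3) → EuclideanSpace ℝ (Fin 3)}
    (hA : 0 ≤ A) (hdec : HasTypeIDecay A v) (hT : FarFieldTruncation M v)
    (hB : EnvelopeCubeBudget v) (hF : RateFloor v) :
    ∃ K₁ K₂ c ε₀ : ℝ, 0 < K₂ ∧ 0 < c ∧ 0 < ε₀ ∧ ε₀ ≤ 1 / 2 ∧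
      TruncatedFamily (M + 1) K₁ K₂ c ε₀ := by
  obtain ⟨c, hc, hfloor⟩ := hF
  obtain ⟨κ, K, hκ, hK, hfam⟩ := hT (min 1 (c / 2)) (by positivity) (min_le_left _ _)
  obtain ⟨B, hB0, hbud⟩ := hB
  have hKpos : 0 < K := by linarith
  -- depth: `ε₀ = min (1/2) ((c / (2(A+c)))²)`
  set η : ℝ := c / (2 * (A + c)) with hη
  have hηpos : 0 < η := by positivity
  refine ⟨32 + 16 * (B + K) * (1 + Real.log K), 16 * (B + K) * (κ + 1) + 1, c / 2,
    min (1 / 2) (η ^ 2), by positivity, by positivity, by positivity, min_le_left _ _, ?_⟩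
  intro ε hε
  have hεpos : 0 < ε := hε.1
  have hεhalf : ε ≤ 1 / 2 := hε.2.trans (min_le_left _ _)
  have hεη : ε ≤ η ^ 2 := hε.2.trans (min_le_right _ _)
  have hεone : ε ≤ 1 := by linarith
  obtain ⟨R, u, p, hR2, hRK, hframe, hrate, ⟨k, hk0, hk3, hL3⟩, hclose⟩ := hfam ε ⟨hεpos, hεhalf⟩
  obtain ⟨b, hb0, hb3, hbv⟩ := hbud R hR2 ε ⟨hεpos, hεone⟩
  have hL3u := hL3 b hb0 hbv
  -- the `L³` level `A_ε = 2 + b + k`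
  have hlog1 : 0 ≤ Real.log (1 / ε) := by
    apply Real.log_nonneg
    rw [le_div_iff₀ hεpos]; linarith
  have hlogR : Real.log R ≤ Real.log K + κ * Real.log (1 / ε) := by
    have hRpos : 0 < R := by linarith
    have h1 : Real.log R ≤ Real.log (K * ε ^ (-κ)) := Real.log_le_log hRpos hRK
    have h2 : Real.log (K * ε ^ (-κ)) = Real.log K + κ * Real.log (1 / ε) := by
      rw [Real.log_mul hKpos.ne' (Real.rpow_pos_of_pos hεpos _).ne', Real.log_rpow hεpos,
        one_div, Real.log_inv]
      ring
    linarith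
  refine ⟨2 + b + k, u, p, hframe, hrate, fun t ht => (hL3u t ht).trans
    (ENNReal.ofReal_le_ofReal (by linarith)), by linarith, ?_, ?_⟩
  · -- the cube-log budget: `(2 + b + k)³ ≤ 32 + 16 b³ + 16 k³ ≤ 32 + 16 (B + K)·L`,
    -- `L = 1 + log R + log(1/ε) ≤ 1 + log K + (κ+1) log(1/ε)`
    have h1 : (2 + b + k) ^ 3 ≤ 4 * 2 ^ 3 + 4 * (b + k) ^ 3 := by
      have := DyadicChaining.add_pow_three_le_four (x := 2) (y := b + k) (by norm_num) (by linarith)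
      calc (2 + b + k) ^ 3 = (2 + (b + k)) ^ 3 := by ring
        _ ≤ 4 * 2 ^ 3 + 4 * (b + k) ^ 3 := this
    have h1' : (b + k) ^ 3 ≤ 4 * b ^ 3 + 4 * k ^ 3 := DyadicChaining.add_pow_three_le_four hb0 hk0
    have hLle : 1 + Real.log R + Real.log (1 / ε) ≤
        1 + Real.log K + (κ + 1) * Real.log (1 / ε) := by linarith
    have hBK : 0 ≤ B + K := by linarith
    have h2 : b ^ 3 + k ^ 3 ≤ (B + K) * (1 + Real.log R + Real.log (1 / ε)) := by nlinarith
    have h3 : (B + K) * (1 + Real.log R + Real.log (1 / ε)) ≤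
        (B + K) * (1 + Real.log K + (κ + 1) * Real.log (1 / ε)) :=
      mul_le_mul_of_nonneg_left hLle hBK
    have h4 : 16 * (B + K) * (κ + 1) * Real.log (1 / ε) ≤
        (16 * (B + K) * (κ + 1) + 1) * Real.log (1 / ε) :=
      mul_le_mul_of_nonneg_right (by linarith) hlog1
    nlinarith [h1, h1', h2, h3, h4]
  · -- the floor, localised into the unit ball by the envelope
    obtain ⟨x, hx⟩ := hfloor (-ε) ⟨by linarith, by linarith⟩
    rw [neg_neg] at hx
    have hsq : 0 < Real.sqrt ε := Real.sqrt_pos.2 hεpos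
    have hsq1 : Real.sqrt ε ≤ 1 := by
      rw [← Real.sqrt_one]; exact Real.sqrt_le_sqrt hεone
    have hsqη : Real.sqrt ε ≤ η := by
      calc Real.sqrt ε ≤ Real.sqrt (η ^ 2) := Real.sqrt_le_sqrt hεη
        _ = η := Real.sqrt_sq hηpos.le
    -- `‖x‖ < 1`
    have henv : ‖v (-ε) x‖ ≤ A / (‖x‖ + Real.sqrt ε) := by
      have := hdec (-ε) (by linarith) x
      simpa only [neg_neg] using this
    have hden : 0 < ‖x‖ + Real.sqrt ε := by positivity
    have h1 : c * (‖x‖ + Real.sqrt ε) ≤ A * Real.sqrt ε :=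
      (div_le_div_iff₀ hsq hden).1 (hx.trans henv)
    have hx1 : ‖x‖ < 1 := by
      have h2 : c * ‖x‖ ≤ A * Real.sqrt ε := by nlinarith [norm_nonneg x]
      have h3 : A * Real.sqrt ε ≤ A * η := mul_le_mul_of_nonneg_left hsqη hA
      have h4 : A * η < c := by
        rw [hη, ← mul_div_assoc, div_lt_iff₀ (by positivity)]
        nlinarith
      nlinarith
    have hxball : x ∈ Metric.ball (0 : EuclideanSpace ℝ (Fin 3)) 1 := by
      rwa [Metric.mem_ball, dist_zero_right]
    -- `‖u(1−ε) x‖ ≥ c/√ε − c/2 ≥ (c/2)/√ε`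
    have hcl := hclose x hxball
    have hδ : min 1 (c / 2) ≤ c / 2 := min_le_right _ _
    have htri : ‖v (-ε) x‖ - ‖u (1 - ε) x‖ ≤ ‖u (1 - ε) x - v (-ε) x‖ := by
      rw [norm_sub_rev]; exact norm_sub_norm_le _ _
    refine ⟨x, ?_⟩
    have hhalf : c / 2 ≤ c / 2 / Real.sqrt ε := by
      rw [le_div_iff₀ hsq]; nlinarith
    have : c / Real.sqrt ε = c / 2 / Real.sqrt ε + c / 2 / Real.sqrt ε := by ring
    linarith

end Summit.NavierStokesRegularity.NavierStokesRegularity.Cruxes.TypeIQuantSubcubicExp.TruncationEdge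

end
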